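import Summits.Ventures.HodgeKum4.Theorems.KummerFixedLocusL1HilbJoinSpan
import HarnessLib

/-!
# Lane (V), line v2p5 — stub S-F (`stub_span`), JOIN half, J1 `UnitReach` part A: unit words and their coordinates

Cell `hodge-kum4`, crux stmt-Ventures-20306 (`LefschetzGenerationHilb5`, W-form), seam `SF.JoinHalf`
(`Theorems/KummerFixedLocusL1HilbSeam`), cut J1 `UnitReach` (plan g19 `SeamSF.v2.PLAN` e3a3fc3607265de7).
This file = plan g19's scratch `J1UnitReach.partAB` f8d96d9bc959a14f, PART A, packaged for the tree by p5 g1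
(names and namespace `…L1Hilb.Unit` verbatim; docstrings added; no statement changed).

Generic bookkeeping over the axioms `IsHeisenbergRepresentation` (any field `K`), on top of p2 g12's
`KummerFixedLocusL1HilbJoinSpan` (`admSpanGe`, `unitWord`, `monomialOp_unitWord_perm`):
* (A1) `numParts ρ` = the number of parts (letters) of a multiplicity function, `= (canonList n ρ).length`, `≤ n`;
* (A2) `coord_component_eq_zero_of_mem_admSpanGe` — a vector of `admSpanGe r` (admissible monomials with `≥ r`
  letters) has ZERO coordinate, in any monomial basis `Bn` of `ℍₙ`, on every index with `< r` parts (the junk killer);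
* (A3) unit-coloured indices ↔ unit words: `partsList`, `pvWord_eq_unitWord`, `unitLetters`,
  `isAdmissibleWord_unitLetters`, `countFn_unitLetters_of_ne`, and `component_unitWord_vac` — the `ℍₙ`-component of
  a unit word vector `U_l|0⟩` is `0` or a basis vector `Bn ρ` with `ρ` unit-coloured;
* (A4) the ℕ-cone `unitCone` generated by the unit-word vectors: stable under unit letters and natural multiples, and
  `coord_component_unitCone` — every basis coordinate of a cone vector is a NATURAL NUMBER, zero off the unit colour.

Kernel-only, standard axioms, 0 named facts.  HONEST FRAMING: helper lemmas; nothing here asserts J1 ∕ S-F ∕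
L1-Hilb(n) ∕ L1 ∕ HC_Kum4Type ∕ HC.
-/
noncomputable section

open DirectSum

universe u v w

namespace Summit.Ventures.HodgeKum4.L1Hilb.Unit

open Literature.AlgebraicGeometry.HilbertScheme Summit.Ventures.HodgeKum4.L1Hilb.Join

variable {K : Type u} [Field K]
variable {A : ℕ → Type v} [∀ i, AddCommGroup (A i)] [∀ i, Module K (A i)]
variable {Φ : ℕ → ℕ → Type w} [∀ n i, AddCommGroup (Φ n i)] [∀ n i, Module K (Φ n i)]
variable {B : (⨁ i, A i) →ₗ[K] (⨁ i, A i) →ₗ[K] K} {q : ℤ → (⨁ i, A i) →ₗ[K] Module.End K (Fock Φ)} {vac : Fock Φ}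
variable {N : ℕ} {x : Fin N → ⨁ i, A i} {deg : Fin N → ℕ}

/-! ### A1. Number of parts -/

/-- The number of parts (letters) of a multiplicity function `ρ`. -/
def numParts {n : ℕ} (ρ : Fin N → Fin (n + 1) → ℕ) : ℕ := ∑ c, ∑ r, ρ c r

/-- The canonical word of `ρ` has `numParts ρ` letters. -/
theorem length_canonList (n : ℕ) (ρ : Fin N → Fin (n + 1) → ℕ) : (canonList n ρ).length = numParts ρ := by
  simp only [canonList, numParts, List.length_flatMap, List.length_replicate, Fin.sum_univ_def]

/-- The count function of a sorted word with parts `≤ n` has as many parts as the word has letters. -/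
theorem numParts_countFn {n : ℕ} {L : List (Lex (Fin N × ℕ))} (hsorted : L.Pairwise (· ≤ ·))
    (hparts : ∀ σ ∈ L, letterPart σ ≤ n) : numParts (countFn n L) = L.length := by
  rw [← length_canonList, canonList_countFn hsorted hparts]

/-- `numParts ρ ≤ n` for a partition-valued `ρ` of size `n` (parts `≥ 1`). -/
theorem numParts_le {n : ℕ} {ρ : Fin N → Fin (n + 1) → ℕ} (hρ : IsPartitionValued deg n ρ) : numParts ρ ≤ n := by
  conv_rhs => rw [← hρ.2.2]
  refine Finset.sum_le_sum fun c _ ↦ Finset.sum_le_sum fun r _ ↦ ?_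
  rcases Nat.eq_zero_or_pos (r : ℕ) with hr | hr
  · have : r = 0 := Fin.ext hr
    rw [this, hρ.1 c]; simp
  · exact Nat.le_mul_of_pos_left _ hr

/-! ### A2. Vectors with at least `r` letters have no coordinates on monomials with fewer parts -/

/-- **Junk has no short coordinates**: if `y ∈ admSpanGe r` then its `ℍₙ`-component has zero coordinate on every basis
monomial with `< r` parts (for any basis `Bn` of `ℍₙ` whose vectors are the Heisenberg monomials). -/
theorem coord_component_eq_zero_of_mem_admSpanGe (h : IsHeisenbergRepresentation B q vac) {n : ℕ}
    (Bn : Module.Basis {ρ : Fin N → Fin (n + 1) → ℕ // IsPartitionValued deg n ρ} K (FockSummand Φ n))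
    (hBn : ∀ ρ, Fock.ofSummand K Φ n (Bn ρ) = heisenbergMonomial q vac x n ρ.1)
    {r : ℕ} {y : Fock Φ} (hy : y ∈ admSpanGe q x vac deg r)
    (ρ : {ρ : Fin N → Fin (n + 1) → ℕ // IsPartitionValued deg n ρ}) (hρ : numParts ρ.1 < r) :
    Bn.coord ρ (DirectSum.component K ℕ (fun p ↦ FockSummand Φ p) n y) = 0 := by
  classical
  induction hy using Submodule.span_induction with
  | mem w hw =>
    obtain ⟨L, hL, hrL, rfl⟩ := hw
    obtain ⟨z, hz⟩ := h.monomialOp_vac_mem_range (letterWord x L)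
    by_cases hn : wordMode (letterWord x L) = n
    · have hpv := isPartitionValued_countFn x hL hn
      have heq : monomialOp q (letterWord x L) vac = Fock.ofSummand K Φ n (Bn ⟨countFn n L, hpv⟩) := by
        rw [hBn, heisenbergMonomial_countFn q vac x hL hn]
      rw [heq, DirectSum.component.lof_self, Module.Basis.coord_apply, Bn.repr_self, Finsupp.single_apply, if_neg]
      intro hρL
      have hparts : ∀ σ ∈ L, letterPart σ ≤ n := fun σ hσ ↦ hn ▸ letterPart_le_wordMode x hσ
      have hlen := numParts_countFn hL.pairwise_le hparts
      rw [show countFn n L = ρ.1 from congrArg Subtype.val hρL] at hlen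
      omega
    · rw [← hz, DirectSum.component.of, dif_neg hn, map_zero]
  | zero => rw [map_zero, map_zero]
  | add a b _ _ ha hb => rw [map_add, map_add, ha, hb, add_zero]
  | smul t a _ ha => rw [map_smul, map_smul, ha, smul_zero]

/-! ### A3. Unit-coloured multiplicity functions and unit words -/

/-- The list of parts of `ρ` in colour `c₀`, ascending (`ρ c₀ r` copies of `r`). -/
def partsList (n : ℕ) (ρ : Fin N → Fin (n + 1) → ℕ) (c₀ : Fin N) : List ℕ :=
  (List.finRange (n + 1)).flatMap fun r ↦ List.replicate (ρ c₀ r) (r : ℕ)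

/-- A `flatMap` over a duplicate-free list all of whose entries but `c₀` contribute nothing (list plumbing). -/
theorem flatMap_eq_of_single {α β : Type*} [DecidableEq α] (L : List α) (hL : L.Nodup) {c₀ : α} (hc : c₀ ∈ L)
    (f : α → List β) (hf : ∀ c ∈ L, c ≠ c₀ → f c = []) : L.flatMap f = f c₀ := by
  induction L with
  | nil => exact (List.not_mem_nil hc).elim
  | cons a L ih =>
    rw [List.flatMap_cons]
    rcases List.mem_cons.1 hc with rfl | hc'
    · have : L.flatMap f = [] :=
        List.flatMap_eq_nil_iff.2 fun c hcL ↦ hf c (List.mem_cons_of_mem _ hcL)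
          (fun h ↦ (List.nodup_cons.1 hL).1 (h ▸ hcL))
      rw [this, List.append_nil]
    · have ha : a ≠ c₀ := fun h ↦ (List.nodup_cons.1 hL).1 (h ▸ hc')
      rw [hf a List.mem_cons_self ha, List.nil_append]
      exact ih (List.nodup_cons.1 hL).2 hc' fun c hcL ↦ hf c (List.mem_cons_of_mem _ hcL)

/-- **A unit-coloured `ρ` has the unit word of its parts**: `pvWord x n ρ = unitWord (x c₀) (partsList n ρ c₀)`. -/
theorem pvWord_eq_unitWord (n : ℕ) (ρ : Fin N → Fin (n + 1) → ℕ) (c₀ : Fin N)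
    (hρ : ∀ c, c ≠ c₀ → ∀ r, ρ c r = 0) : pvWord x n ρ = unitWord (x c₀) (partsList n ρ c₀) := by
  classical
  rw [pvWord, flatMap_eq_of_single (List.finRange N) (List.nodup_finRange N) (List.mem_finRange c₀)]
  · simp only [partsList, unitWord, List.map_flatMap, List.map_replicate]
  · intro c _ hc
    exact List.flatMap_eq_nil_iff.2 fun r _ ↦ by rw [hρ c hc r, List.replicate_zero]

/-- An entry of `partsList` is a part `r` with positive multiplicity `ρ c₀ r`. -/
theorem mem_partsList {n : ℕ} {ρ : Fin N → Fin (n + 1) → ℕ} {c₀ : Fin N} {b : ℕ} (hb : b ∈ partsList n ρ c₀) :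
    ∃ r : Fin (n + 1), (r : ℕ) = b ∧ 0 < ρ c₀ r := by
  simp only [partsList, List.mem_flatMap, List.mem_finRange, true_and, List.mem_replicate] at hb
  obtain ⟨r, hne, rfl⟩ := hb
  exact ⟨r, rfl, Nat.pos_of_ne_zero hne⟩

/-- The entries of `partsList` of a partition-valued `ρ` are `≥ 1`. -/
theorem one_le_of_mem_partsList {n : ℕ} {ρ : Fin N → Fin (n + 1) → ℕ} (hρ : IsPartitionValued deg n ρ) {c₀ : Fin N}
    {b : ℕ} (hb : b ∈ partsList n ρ c₀) : 1 ≤ b := by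
  obtain ⟨r, rfl, hr⟩ := mem_partsList hb
  by_contra h0
  have : r = 0 := Fin.ext (by simpa using h0)
  rw [this, hρ.1 c₀] at hr
  exact lt_irrefl 0 hr

/-- For a unit-coloured `ρ`, `partsList` has `numParts ρ` entries. -/
theorem length_partsList {n : ℕ} (ρ : Fin N → Fin (n + 1) → ℕ) (c₀ : Fin N) (hρ : ∀ c, c ≠ c₀ → ∀ r, ρ c r = 0) :
    (partsList n ρ c₀).length = numParts ρ := by
  classical
  rw [numParts, Finset.sum_eq_single c₀ (fun c _ hc ↦ Finset.sum_eq_zero fun r _ ↦ hρ c hc r)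
    (fun h ↦ (h (Finset.mem_univ _)).elim)]
  simp only [partsList, List.length_flatMap, List.length_replicate, Fin.sum_univ_def]

/-- The index-letter word of a list of parts, all of colour `c₀`. -/
def unitLetters (c₀ : Fin N) (l : List ℕ) : List (Lex (Fin N × ℕ)) := l.map fun b ↦ toLex (c₀, b)

/-- The letter word of `unitLetters c₀ l` is the unit word of `l` on the class `x c₀`. -/
theorem letterWord_unitLetters (c₀ : Fin N) (l : List ℕ) : letterWord x (unitLetters c₀ l) = unitWord (x c₀) l := by
  simp [letterWord, unitLetters, unitWord]

/-- `unitLetters` preserves the length. -/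
@[simp] theorem length_unitLetters (c₀ : Fin N) (l : List ℕ) : (unitLetters c₀ l).length = l.length := by
  simp [unitLetters]

/-- A sorted list of positive parts in an EVEN colour gives an admissible word. -/
theorem isAdmissibleWord_unitLetters {c₀ : Fin N} (hc₀ : Even (deg c₀)) {l : List ℕ} (hl : ∀ b ∈ l, 1 ≤ b)
    (hsorted : l.Pairwise (· ≤ ·)) : IsAdmissibleWord deg (unitLetters c₀ l) := by
  refine ⟨fun σ hσ ↦ ?_, ?_⟩
  · obtain ⟨b, hb, rfl⟩ := List.mem_map.1 hσ
    exact hl b hb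
  · rw [unitLetters, List.pairwise_map]
    refine hsorted.imp fun {a b} hab ↦ ⟨?_, fun hodd ↦ ?_⟩
    · exact Prod.Lex.toLex_mono ⟨le_rfl, hab⟩
    · exact (Nat.not_odd_iff_even.2 hc₀ hodd).elim

/-- The count function of a word of unit letters vanishes off the colour `c₀`. -/
theorem countFn_unitLetters_of_ne (n : ℕ) (c₀ : Fin N) (l : List ℕ) {c : Fin N} (hc : c ≠ c₀) (r : Fin (n + 1)) :
    countFn n (unitLetters c₀ l) c r = 0 := by
  rw [countFn, List.count_eq_zero]
  intro hmem
  obtain ⟨b, _, hb⟩ := List.mem_map.1 hmem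
  have := congrArg (fun σ : Lex (Fin N × ℕ) ↦ (ofLex σ).1) hb
  exact hc (by simpa using this.symm)

/-- The total mode of a unit word is the sum of its parts (alias of p2's `Join.wordMode_unitWord`). -/
theorem wordMode_unitWord' (u : ⨁ i, A i) (l : List ℕ) : wordMode (unitWord u l) = l.sum := wordMode_unitWord u l

/-- **Coordinates of a unit-word vector**: for a list `l` of positive parts (colour `c₀` even, `x c₀ ∈ A 0`), the
`ℍₙ`-component of `U_l|0⟩` is either `0` or a basis vector `Bn ρ_l` with `ρ_l` unit-coloured. -/
theorem component_unitWord_vac (h : IsHeisenbergRepresentation B q vac) {n : ℕ}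
    (Bn : Module.Basis {ρ : Fin N → Fin (n + 1) → ℕ // IsPartitionValued deg n ρ} K (FockSummand Φ n))
    (hBn : ∀ ρ, Fock.ofSummand K Φ n (Bn ρ) = heisenbergMonomial q vac x n ρ.1)
    {c₀ : Fin N} (hc₀ : deg c₀ = 0) (hx₀ : x c₀ ∈ LinearMap.range (lof K ℕ A 0))
    (l : List ℕ) (hl : ∀ b ∈ l, 1 ≤ b) :
    DirectSum.component K ℕ (fun p ↦ FockSummand Φ p) n (monomialOp q (unitWord (x c₀) l) vac) = 0 ∨
      ∃ ρ : {ρ : Fin N → Fin (n + 1) → ℕ // IsPartitionValued deg n ρ}, (∀ c, c ≠ c₀ → ∀ r, ρ.1 c r = 0) ∧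
        DirectSum.component K ℕ (fun p ↦ FockSummand Φ p) n (monomialOp q (unitWord (x c₀) l) vac) = Bn ρ := by
  classical
  -- sort the parts
  set ls := l.insertionSort (· ≤ ·) with hls
  have hperm : ls.Perm l := List.perm_insertionSort _ _
  have hsorted : ls.Pairwise (· ≤ ·) := List.pairwise_insertionSort _ _
  have hls1 : ∀ b ∈ ls, 1 ≤ b := fun b hb ↦ hl b (hperm.mem_iff.1 hb)
  have hU : monomialOp q (unitWord (x c₀) l) = monomialOp q (unitWord (x c₀) ls) :=
    monomialOp_unitWord_perm h hx₀ hperm.symm hl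
  rw [hU, ← letterWord_unitLetters]
  have hadm : IsAdmissibleWord deg (unitLetters c₀ ls) :=
    isAdmissibleWord_unitLetters (by rw [hc₀]; exact ⟨0, rfl⟩) hls1 hsorted
  obtain ⟨z, hz⟩ := h.monomialOp_vac_mem_range (letterWord x (unitLetters c₀ ls))
  by_cases hn : wordMode (letterWord x (unitLetters c₀ ls)) = n
  · right
    have hpv : IsPartitionValued deg n (countFn n (unitLetters c₀ ls)) := isPartitionValued_countFn x hadm hn
    refine ⟨⟨countFn n (unitLetters c₀ ls), hpv⟩, fun c hc r ↦ countFn_unitLetters_of_ne n c₀ ls hc r, ?_⟩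
    have hb := hBn ⟨countFn n (unitLetters c₀ ls), hpv⟩
    rw [heisenbergMonomial_countFn q vac x hadm hn] at hb
    rw [← hb, DirectSum.component.lof_self]
  · left
    rw [← hz, DirectSum.component.of, dif_neg hn]

/-! ### A4. The ℕ-cone of unit-word vectors -/

/-- The additive submonoid generated by the unit-word vectors `U_l|0⟩` (parts `≥ 1`). -/
def unitCone (q : ℤ → (⨁ i, A i) →ₗ[K] Module.End K (Fock Φ)) (vac : Fock Φ) (u : ⨁ i, A i) :
    AddSubmonoid (Fock Φ) :=
  AddSubmonoid.closure {v | ∃ l : List ℕ, (∀ b ∈ l, 1 ≤ b) ∧ v = monomialOp q (unitWord u l) vac}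

/-- The generators `U_l|0⟩` lie in the cone. -/
theorem unitWord_vac_mem_unitCone (u : ⨁ i, A i) {l : List ℕ} (hl : ∀ b ∈ l, 1 ≤ b) :
    monomialOp q (unitWord u l) vac ∈ unitCone q vac u :=
  AddSubmonoid.subset_closure ⟨l, hl, rfl⟩

/-- A unit letter `𝔮ₐ(u)`, `a ≥ 1`, maps the cone into itself. -/
theorem q_apply_mem_unitCone (u : ⨁ i, A i) {a : ℕ} (ha : 1 ≤ a) {v : Fock Φ} (hv : v ∈ unitCone q vac u) :
    q (a : ℤ) u v ∈ unitCone q vac u := by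
  induction hv using AddSubmonoid.closure_induction with
  | mem w hw =>
    obtain ⟨l, hl, rfl⟩ := hw
    rw [← Module.End.mul_apply, ← monomialOp_cons, ← unitWord_cons]
    exact unitWord_vac_mem_unitCone u (by simpa [ha] using hl)
  | zero => rw [map_zero]; exact AddSubmonoid.zero_mem _
  | add a b _ _ ha hb => rw [map_add]; exact AddSubmonoid.add_mem _ ha hb

/-- A natural multiple of a cone vector is in the cone. -/
theorem natCast_smul_mem_unitCone (u : ⨁ i, A i) (m : ℕ) {v : Fock Φ} (hv : v ∈ unitCone q vac u) :
    (m : K) • v ∈ unitCone q vac u := by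
  rw [Nat.cast_smul_eq_nsmul]
  exact AddSubmonoid.nsmul_mem _ hv m

/-- **Cone vectors have natural-number coordinates, zero off the unit colour.** -/
theorem coord_component_unitCone (h : IsHeisenbergRepresentation B q vac) {n : ℕ}
    (Bn : Module.Basis {ρ : Fin N → Fin (n + 1) → ℕ // IsPartitionValued deg n ρ} K (FockSummand Φ n))
    (hBn : ∀ ρ, Fock.ofSummand K Φ n (Bn ρ) = heisenbergMonomial q vac x n ρ.1)
    {c₀ : Fin N} (hc₀ : deg c₀ = 0) (hx₀ : x c₀ ∈ LinearMap.range (lof K ℕ A 0))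
    {v : Fock Φ} (hv : v ∈ unitCone q vac (x c₀)) (ρ : {ρ : Fin N → Fin (n + 1) → ℕ // IsPartitionValued deg n ρ}) :
    ∃ m : ℕ, Bn.coord ρ (DirectSum.component K ℕ (fun p ↦ FockSummand Φ p) n v) = m ∧
      ((∃ c, c ≠ c₀ ∧ ∃ r, ρ.1 c r ≠ 0) → m = 0) := by
  classical
  induction hv using AddSubmonoid.closure_induction with
  | mem w hw =>
    obtain ⟨l, hl, rfl⟩ := hw
    rcases component_unitWord_vac h Bn hBn hc₀ hx₀ l hl with h0 | ⟨ρ', hρ', heq⟩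
    · exact ⟨0, by rw [h0, map_zero, Nat.cast_zero], fun _ ↦ rfl⟩
    · rw [heq, Module.Basis.coord_apply, Bn.repr_self, Finsupp.single_apply]
      by_cases hρρ : ρ' = ρ
      · refine ⟨1, by rw [if_pos hρρ, Nat.cast_one], fun ⟨c, hc, r, hr⟩ ↦ ?_⟩
        exact (hr (hρρ ▸ hρ' c hc r)).elim
      · exact ⟨0, by rw [if_neg hρρ, Nat.cast_zero], fun _ ↦ rfl⟩
  | zero => exact ⟨0, by rw [map_zero, map_zero, Nat.cast_zero], fun _ ↦ rfl⟩
  | add a b _ _ ha hb =>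
    obtain ⟨ma, hma, hma0⟩ := ha
    obtain ⟨mb, hmb, hmb0⟩ := hb
    exact ⟨ma + mb, by rw [map_add, map_add, hma, hmb, Nat.cast_add], fun hc ↦ by rw [hma0 hc, hmb0 hc]⟩



end Summit.Ventures.HodgeKum4.L1Hilb.Unit

end
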